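/-
Origin: expansion seat `prover-pub-hodgecm-mc-binder-2-g12-0`, handover #58 2026-08-20T06:18Z md5 3e20a3a48487 (158 l.; CERTIFIED private mirror over PKG RUN-39/40 oleans: rc 0 / 0 err / 0 warn / 150 s (one `set_option maxHeartbeats 400000 in` on §1, elaboration of the tree ENGINE call); `#print axioms` of cmArchWeilRep_letterSection_apply · setOf_eigen_letters_eq_closure_span ⊆ {propext, Classical.choice, Quot.sound} (`g12/certs/axioms-58-59.log`); imports #48 `HypCensus/LetterIns` (RUN 39), K-1 `Vendored/H21/Analysis/SegalBargmann/SchwartzIsotypicFockPolynomials` (RUN 35; the tree file EARMARKED for rows A12/A34 field `dense`); (J-dense) STEP (iii), GENERIC PIN FORM: §1 abbrev `letterBlockOf h := cmLetterBlock … (Pi.evalMonoidHom) h`, **`cmArchWeilRep_letterSection_apply`**: under the four sign facts, for EVERY letter tuple h and EVERY Schwartz f, `ω_∞(letterSection h) f = letterChar h • 𝔢*⁻¹ (unitaryOpPi (letterBlockOf h) (𝔢* f))`, `𝔢 = cmBigFrame` — THE COMPACT-LETTER ENGINE (#32/#48) AT OPERATOR LEVEL (tree `IsArchWeilDatum.exists_eq_compactWeilRep`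 on `isArchWeilDatum_repTransport_cmArchWeilRep_of_signs`, the fresh character identified with #48's `letterChar` by vacuum pinning `cmArchWeilRep_letterSection_follandFock_one` + `binvPi_injective`); §2 **`setOf_eigen_letters_eq_closure_span`**: for any family of letter tuples `hh i`, scalars `c₀ i`, eigenvalues `c i`: `{f | ∀ i, c₀ i • ω_∞(letterSection (hh i)) f = c i • f} = closure (span (follandFock 𝔢 '' isotypicFockPolys (letterBlockOf ∘ hh) (c₀ · letterChar ∘ hh) c))` (tree `setOf_eigen_eq_closure_span_of_frame`, Folland 1989 Ch. 4 §5), `mem_closure_span_follandFock_of_eigen_letters`; 0 Prop-defs / 0 records / 0 proof-hole-class tokens; FQN scan vs PKG RUN-42 world + mc/*/pkg + stage42: 0 collisions; NAME LIST `HodgeCM.Model.HypCensus.cmArchWeilRep_letterSection_apply` · `HodgeCM.Model.HypCensus.setOf_eigen_letters_eq_closure_span` · `HodgeCM.Model.HypCensus.letterBlockOf`) (`HOME/mc/pub-hodgecm-mc-binder-2/g12/pkg/HodgeCM/Model/HypCensus/DenseArch.lean`, md5 3e20a3a48487, 158 lines);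
landed by the gen-16 packager (p-g16) in gate run 43 as `HodgeCM/Model/HypCensus/DenseArch.lean` (verbatim).
-/
/-
Copyright (c) 2026. All rights reserved.
Released under Apache 2.0 license as described in the file LICENSE.
-/
import Summits.HodgeConjecture.HodgeCM.Model.HypCensus.LetterIns
import Literature.Analysis.SegalBargmann.SchwartzIsotypicFockPolynomials

/-!
# (J-dense), step (iii): the compact-letter ENGINE at OPERATOR level, and the archimedean isotypic closure

Binder-2 lineage, rows 18/19 (`hyp12`/`hyp34`), field `dense` of `HypCoreW`.

* §1 `cmArchWeilRep_letterSection_apply`: under the four sign facts of the pin, for EVERY letter tuple `h` and EVERY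
  Schwartz function `f` on `(Fin 6 → L⁺ ⊗ ℝ)`,
  `ω_∞(letterSection h) f = letterChar h • 𝔢*⁻¹ (μ₀(cmLetterBlock h) (𝔢* f))`, `𝔢 = cmBigFrame` —
  the operator-level form of #48's `cmArchWeilRep_letterSection_follandFock` (there: on Fock polynomial vectors only),
  from the tree's `IsArchWeilDatum.exists_eq_compactWeilRep` with the character identified with `letterChar` by the
  vacuum pinning.
* §2 `setOf_eigen_letters_eq_closure_span`: for any scalars `c₀ h` and eigenvalues `c h` on any family of letter
  tuples `hh i`, the joint eigenspace `{f | ∀ i, c₀ i • ω_∞(letterSection (hh i)) f = c i • f}` IS the Schwartz-closure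
  of the span of the Folland–Fock vectors `follandFock 𝔢 G` of the HOMOGENEOUS polynomials `G` with
  `(c₀ i · letterChar (hh i)) • (G ∘ letters⁻¹) = c i • G` (tree `setOf_eigen_eq_closure_span_of_frame`,
  Folland 1989 Ch. 4 §5).  With #57 (`SK = 𝒮_∞^κ ⊗ 𝒮_f`) and #50 (`archPairOf k = letterSection (kVLetters (lett k))`)
  this is the archimedean half of (J-dense).
[cite: Folland1989, Prop (4.39), Ch. 4 §5]
-/

noncomputable section

open NumberField NumberField.InfinitePlace IsDedekindDomain
open scoped Matrix Classical TensorProduct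
open MvPolynomial
open Literature.NumberTheory.Automorphic Literature.NumberTheory.Automorphic.UnitaryGroup Literature.NumberTheory.Weil1964
open Literature.RepresentationTheory.KonnoKonno2007 Literature.RepresentationTheory.KonnoKonno2007.RealDualPair
open Literature.NumberTheory.GelbartRogawski1991 Literature.NumberTheory.GelbartRogawski1991.UnitaryDualPair
open Literature.Analysis.SegalBargmann

namespace HodgeCM.Model.HypCensus

section Letters

variable (L : Type) [Field L] [NumberField L] [IsCMField L]
variable (dV : Fin 3 → L) (hdV : ∀ i, IsCMField.complexConj L (dV i) = dV i) (hdV0 : ∀ i, dV i ≠ 0)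
variable (dW : Fin 2 → L) (hdW : ∀ i, IsCMField.complexConj L (dW i) = dW i) (hdW0 : ∀ i, dW i ≠ 0)
variable (hGR : (cmSplittingDatum L finProdFinEquiv dV hdV hdV0 dW hdW hdW0).CompatibleSplitting) (ι₁ : L →+* ℂ)
variable
  (h₁V : ∃ i₀ : Fin 3, (∀ i, i ≠ i₀ → 0 < (ι₁ (dV i)).re) ∨ ∀ i, i ≠ i₀ → (ι₁ (dV i)).re < 0)
  (h₁W : (∀ j, 0 < (ι₁ (dW j)).re) ∨ ∀ j, (ι₁ (dW j)).re < 0)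
  (hV : ∀ τ : L →+* ℂ, InfinitePlace.mk τ ≠ InfinitePlace.mk ι₁ → (∀ i, 0 < (τ (dV i)).re) ∨ ∀ i, (τ (dV i)).re < 0)
  (hW : ∀ τ : L →+* ℂ, InfinitePlace.mk τ ≠ InfinitePlace.mk ι₁ →
    (∃ j₀ : Fin 2, ∀ j, j ≠ j₀ → 0 < (τ (dW j)).re) ∨ ∀ j, (τ (dW j)).re < 0)

/-- The letter block of a letter tuple (the unitary of `Fin 6 × places` by which `ω_∞(letterSection h)` substitutes). -/
abbrev letterBlockOf
    (h : ∀ v : {v : InfinitePlace ↥(maximalRealSubfield L) // v.IsReal},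
      DPK (PosIdx (cmXV L dV hdV ι₁ v)) (NegIdx (cmXV L dV hdV ι₁ v)) (PosIdx (cmXW L dV dW hdW ι₁ v)) (NegIdx (cmXW L dV dW hdW ι₁ v))) :
    Matrix.unitaryGroup (Fin 6 × {v : InfinitePlace ↥(maximalRealSubfield L) // v.IsReal}) ℂ :=
  cmLetterBlock L finProdFinEquiv dV hdV dW hdW ι₁ (fun v => Pi.evalMonoidHom _ v) h

/-! ## §1 the ENGINE at operator level -/

set_option maxHeartbeats 400000 in
include h₁V h₁W hV hW in
/-- **Operator-level compact-letter engine**: `ω_∞(letterSection h) f = letterChar h • 𝔢*⁻¹ (μ₀(letterBlockOf h) (𝔢* f))`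
for EVERY Schwartz `f` (tree `IsArchWeilDatum.exists_eq_compactWeilRep`; the character is `letterChar` by vacuum pinning).
[cite: Folland1989, Prop (4.39)] -/
theorem cmArchWeilRep_letterSection_apply
    (h : ∀ v : {v : InfinitePlace ↥(maximalRealSubfield L) // v.IsReal},
      DPK (PosIdx (cmXV L dV hdV ι₁ v)) (NegIdx (cmXV L dV hdV ι₁ v)) (PosIdx (cmXW L dV dW hdW ι₁ v)) (NegIdx (cmXW L dV dW hdW ι₁ v)))
    (f : SchwartzMap (Fin 6 → mixedEmbedding.mixedSpace (↥(maximalRealSubfield L))) ℂ) :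
    cmArchWeilRep L finProdFinEquiv dV hdV hdV0 dW hdW hdW0 hGR (letterSection L dV hdV hdV0 dW hdW hdW0 ι₁ h) f =
      ((letterChar L dV hdV hdV0 dW hdW hdW0 hGR ι₁ h₁V h₁W hV hW h : Circle) : ℂ) •
        (schwartzTransport (cmBigFrame L finProdFinEquiv dV hdV hdV0 dW hdW hdW0 ι₁)).symm
          (unitaryOpPi (letterBlockOf L dV hdV dW hdW ι₁ h)
            (schwartzTransport (cmBigFrame L finProdFinEquiv dV hdV hdV0 dW hdW hdW0 ι₁) f)) := by
  have hWD : IsArchWeilDatum (cmArchPairPhaseHom L finProdFinEquiv dV hdV hdV0 dW hdW hdW0 ι₁)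
      (repTransport (cmBigFrame L finProdFinEquiv dV hdV hdV0 dW hdW hdW0 ι₁)
        (cmArchWeilRep L finProdFinEquiv dV hdV hdV0 dW hdW hdW0 hGR)) :=
    isArchWeilDatum_repTransport_cmArchWeilRep_of_signs L finProdFinEquiv dV hdV hdV0 dW hdW hdW0 hGR ι₁ h₁V h₁W hV hW
  obtain ⟨χ, -, hχ⟩ := hWD.exists_eq_compactWeilRep (letterSection L dV hdV hdV0 dW hdW hdW0 ι₁)
    (continuous_letterSection L dV hdV hdV0 dW hdW hdW0 ι₁)
    (cmLetterBlock L finProdFinEquiv dV hdV dW hdW ι₁ (fun v => Pi.evalMonoidHom _ v))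
    (cmArchPairPhaseHom_eq_realifySp_of_components L finProdFinEquiv dV hdV hdV0 dW hdW hdW0 ι₁
      (letterSection L dV hdV hdV0 dW hdW hdW0 ι₁) (fun v => Pi.evalMonoidHom _ v)
      (cmPlaceComponent_letterSection L dV hdV hdV0 dW hdW hdW0 ι₁))
  -- the fresh character `χ` IS `letterChar` (both are pinned by the vacuum `follandFock 𝔢 1`)
  have hpin : ((χ h : Circle) : ℂ) = ((letterChar L dV hdV hdV0 dW hdW hdW0 hGR ι₁ h₁V h₁W hV hW h : Circle) : ℂ) := by
    -- both sides applied to the vacuum `binvPi 1 = 𝔢* (follandFock 𝔢 1)`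
    have h1 := hχ h (binvPi 1)
    rw [compactWeilRep_binvPi, Literature.Analysis.SegalBargmann.linSubst_one, repTransport_apply] at h1
    have h2 := congrArg (schwartzTransport (cmBigFrame L finProdFinEquiv dV hdV hdV0 dW hdW hdW0 ι₁))
      (cmArchWeilRep_letterSection_follandFock_one L dV hdV hdV0 dW hdW hdW0 hGR ι₁ h₁V h₁W hV hW h)
    rw [map_smul, schwartzTransport_follandFock, follandFock] at h2
    -- `h2 : 𝔢* (ω (follandFock 𝔢 1)) = letterChar h • binvPi 1`, `h1 : 𝔢* (ω (𝔢*⁻¹ (binvPi 1))) = χ h • binvPi 1`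
    have h12 : ((χ h : Circle) : ℂ) • (binvPi (1 : MvPolynomial (Fin 6 × {v : InfinitePlace ↥(maximalRealSubfield L) // v.IsReal}) ℂ)) =
        ((letterChar L dV hdV hdV0 dW hdW hdW0 hGR ι₁ h₁V h₁W hV hW h : Circle) : ℂ) • binvPi 1 :=
      h1.symm.trans h2
    have hne : (binvPi (1 : MvPolynomial (Fin 6 × {v : InfinitePlace ↥(maximalRealSubfield L) // v.IsReal}) ℂ)) ≠ 0 := by
      intro h0
      have hz : (binvPi (0 : MvPolynomial (Fin 6 × {v : InfinitePlace ↥(maximalRealSubfield L) // v.IsReal}) ℂ)) = 0 := by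
        rw [← zero_smul ℂ (1 : MvPolynomial (Fin 6 × {v : InfinitePlace ↥(maximalRealSubfield L) // v.IsReal}) ℂ),
          binvPi_smul, zero_smul]
      exact one_ne_zero (binvPi_injective (h0.trans hz.symm))
    exact smul_left_injective ℂ hne h12
  have h3 := hχ h (schwartzTransport (cmBigFrame L finProdFinEquiv dV hdV hdV0 dW hdW hdW0 ι₁) f)
  rw [repTransport_apply, ContinuousLinearEquiv.symm_apply_apply, compactWeilRep_apply, hpin] at h3
  have h4 := congrArg (schwartzTransport (cmBigFrame L finProdFinEquiv dV hdV hdV0 dW hdW hdW0 ι₁)).symm h3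
  rw [ContinuousLinearEquiv.symm_apply_apply, map_smul] at h4
  exact h4

/-! ## §2 joint letter-eigenspaces are closures of spans of isotypic Folland–Fock vectors -/

include h₁V h₁W hV hW in
/-- **Archimedean isotypic closure, letters form.** For any index type, letter tuples `hh i`, scalars `c₀ i` and
eigenvalues `c i`: the joint eigenspace of the operators `c₀ i • ω_∞(letterSection (hh i))` on `𝓢((Fin 6 → L⁺ ⊗ ℝ), ℂ)`
IS the closure of the span of `follandFock 𝔢 G`, `G` homogeneous with `(c₀ i · letterChar (hh i)) • (G ∘ letters(hh i)⁻¹) = c i • G`.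
[cite: Folland1989, Ch. 4 §5] -/
theorem setOf_eigen_letters_eq_closure_span {ι : Type*}
    (hh : ι → ∀ v : {v : InfinitePlace ↥(maximalRealSubfield L) // v.IsReal},
      DPK (PosIdx (cmXV L dV hdV ι₁ v)) (NegIdx (cmXV L dV hdV ι₁ v)) (PosIdx (cmXW L dV dW hdW ι₁ v)) (NegIdx (cmXW L dV dW hdW ι₁ v)))
    (c₀ c : ι → ℂ) :
    {f : SchwartzMap (Fin 6 → mixedEmbedding.mixedSpace (↥(maximalRealSubfield L))) ℂ |
        ∀ i, c₀ i • cmArchWeilRep L finProdFinEquiv dV hdV hdV0 dW hdW hdW0 hGR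
          (letterSection L dV hdV hdV0 dW hdW hdW0 ι₁ (hh i)) f = c i • f} =
      closure (Submodule.span ℂ
        ((fun G => follandFock (cmBigFrame L finProdFinEquiv dV hdV hdV0 dW hdW hdW0 ι₁) G) ''
          isotypicFockPolys (fun i => letterBlockOf L dV hdV dW hdW ι₁ (hh i))
            (fun i => c₀ i * ((letterChar L dV hdV hdV0 dW hdW hdW0 hGR ι₁ h₁V h₁W hV hW (hh i) : Circle) : ℂ)) c) :
        Set (SchwartzMap (Fin 6 → mixedEmbedding.mixedSpace (↥(maximalRealSubfield L))) ℂ)) :=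
  setOf_eigen_eq_closure_span_of_frame (cmBigFrame L finProdFinEquiv dV hdV hdV0 dW hdW hdW0 ι₁)
    (fun i => letterBlockOf L dV hdV dW hdW ι₁ (hh i)) _ c
    (A := fun i => c₀ i • (cmArchWeilRep L finProdFinEquiv dV hdV hdV0 dW hdW hdW0 hGR
      (letterSection L dV hdV hdV0 dW hdW hdW0 ι₁ (hh i)) : _ →ₗ[ℂ] _))
    fun i f => by
      rw [LinearMap.smul_apply, cmArchWeilRep_letterSection_apply L dV hdV hdV0 dW hdW hdW0 hGR ι₁ h₁V h₁W hV hW,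
        smul_smul]

include h₁V h₁W hV hW in
/-- Membership form of `setOf_eigen_letters_eq_closure_span`. [cite: Folland1989, Ch. 4 §5] -/
theorem mem_closure_span_follandFock_of_eigen_letters {ι : Type*}
    (hh : ι → ∀ v : {v : InfinitePlace ↥(maximalRealSubfield L) // v.IsReal},
      DPK (PosIdx (cmXV L dV hdV ι₁ v)) (NegIdx (cmXV L dV hdV ι₁ v)) (PosIdx (cmXW L dV dW hdW ι₁ v)) (NegIdx (cmXW L dV dW hdW ι₁ v)))
    (c₀ c : ι → ℂ) {f : SchwartzMap (Fin 6 → mixedEmbedding.mixedSpace (↥(maximalRealSubfield L))) ℂ}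
    (hf : ∀ i, c₀ i • cmArchWeilRep L finProdFinEquiv dV hdV hdV0 dW hdW hdW0 hGR
      (letterSection L dV hdV hdV0 dW hdW hdW0 ι₁ (hh i)) f = c i • f) :
    f ∈ closure (Submodule.span ℂ
        ((fun G => follandFock (cmBigFrame L finProdFinEquiv dV hdV hdV0 dW hdW hdW0 ι₁) G) ''
          isotypicFockPolys (fun i => letterBlockOf L dV hdV dW hdW ι₁ (hh i))
            (fun i => c₀ i * ((letterChar L dV hdV hdV0 dW hdW hdW0 hGR ι₁ h₁V h₁W hV hW (hh i) : Circle) : ℂ)) c) :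
        Set (SchwartzMap (Fin 6 → mixedEmbedding.mixedSpace (↥(maximalRealSubfield L))) ℂ)) := by
  rw [← setOf_eigen_letters_eq_closure_span L dV hdV hdV0 dW hdW hdW0 hGR ι₁ h₁V h₁W hV hW hh c₀ c]
  exact hf

end Letters

end HodgeCM.Model.HypCensus

end
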